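import Literature.NumberTheory.NumberFields.EisensteinFieldSelmerInert
import Literature.NumberTheory.NumberFields.EisensteinFieldSelmerNormCube
import HarnessLib

/-!
# `K(S, 3)` of `ℚ(ζ₃)`, `S = {λ} ∪ {q ∣ N}` with the `q` inert: the classes whose NORM is a rational cube
# are `[ζ^i]` only (Cohen–Pazuki's `G₃` meets the `S`-box in `⟨[ζ₃]⟩`)

Topic `NumberTheory/NumberFields`. Generalisation of `EisensteinFieldSelmerNormCube` (the case `N = 10`,
`S = {λ, 2, 5}`) to an arbitrary `N ≠ 0` all of whose prime factors are `2` or `≡ 2 (mod 3)` (inert in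
`K3 = ℚ(ζ₃)`), on top of the normal forms `b = s ζ^i (ζ − 1)^j (∏_{q ∣ N} q^{e_q}) w³` of
`EisensteinFieldSelmerInert`. For the `3`-isogeny descent of Cohen–Pazuki ([CohenPazuki2009], Def. 1.3,
Thm. 2.1) on `y² = x³ − 3(âx + b̂)²` this computes the Selmer box of the `ℤ/3`-kernel side whenever
`2b̂√−3` is supported on `λ` and inert primes: it is `{[1], [ζ], [ζ²]}` — the norm-cube condition kills
`λ` (`N(ζ − 1) = 3`) and every inert `q` (`N(q) = q²`).

* `K3.norm_prodPow`, `K3.norm_normalForm_inert` — `N(s ζ^i (ζ−1)^j (∏ q^{e_q}) w³) = 3^j (∏ q^{2e_q}) N(w)³`;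
* `K3.padicValRat_prodPow_sq` — `v_p(∏_{q ∈ s} q^{2e_q}) = 2e_p` (`p ∈ s`) or `0`;
* **`K3.exponents_eq_zero_of_norm_cube_inert`** — norm a cube ⇒ `j = 0` and `e_q = 0` for `q ∣ N`;
* **`K3.exists_cubeClass_eq_zeta_pow_of_norm_cube_inert`** — `b ∈ K3ˣ`, `3 ∣ ord_v(b)` for all `v ∌ 3N`,
  `N(b) ∈ ℚ*³` ⇒ `[b] = [ζ^i]`, `i < 3`.

## References

* [CohenPazuki2009] H. Cohen, F. Pazuki, Acta Arith. 140 (2009), Definition 1.3 (`G₃`), Theorem 2.1.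
* [SilvermanAEC2009] J. H. Silverman, *AEC* 2nd ed., Prop. VIII.1.6 (`K(S, n)`).
-/

noncomputable section

open QuadraticAlgebra NumberField IsDedekindDomain IsDedekindDomain.HeightOneSpectrum
open WithZero (log exp)
open scoped WithZero
open Literature.NumberTheory.EllipticCurves.MordellDescent (cubeClass CubeUnits cubeClass_mul
  cubeClass_neg cubeClass_mul_pow_three cubeClass_eq_cubeClass_iff cubeClass_pow_three)

namespace Literature.NumberTheory.NumberFields

namespace K3

/-! ## Norms -/

/-- `N(∏_{q ∈ s} q^{e_q}) = ∏_{q ∈ s} (q²)^{e_q}` (`N(q) = q²` for `q ∈ ℕ`). [cite: CohenPazuki2009, Definition 1.3 (G₃)] -/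
theorem norm_prodPow (s : Finset ℕ) (e : ℕ → ℕ) :
    QuadraticAlgebra.norm (∏ q ∈ s, (q : K3) ^ e q) = ∏ q ∈ s, ((q : ℚ) ^ 2) ^ e q := by
  rw [map_prod]
  refine Finset.prod_congr rfl fun q _ => ?_
  rw [map_pow, QuadraticAlgebra.norm_natCast]

/-- `N(s) = 1` for `s = ±1` (private). [cite: CohenPazuki2009, Definition 1.3 (G₃)] -/
private theorem norm_sign' {s : ℤ} (hs : s = 1 ∨ s = -1) : QuadraticAlgebra.norm ((s : ℤ) : K3) = 1 := by
  rw [norm_intCast]; rcases hs with rfl | rfl <;> norm_num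

/-- **The norm of an inert normal form**: `N(s ζ^i (ζ−1)^j (∏ q^{e_q}) w³) = 3^j (∏ (q²)^{e_q}) N(w)³`.
[cite: CohenPazuki2009, Definition 1.3 (G₃) with Theorem 2.1] -/
theorem norm_normalForm_inert {N : ℕ} {s : ℤ} (hs : s = 1 ∨ s = -1) (i j : ℕ) (e : ℕ → ℕ) (w : K3) :
    QuadraticAlgebra.norm ((s : K3) * zeta ^ i * (zeta - 1) ^ j * (∏ q ∈ N.primeFactors, (q : K3) ^ e q) * w ^ 3) =
      3 ^ j * (∏ q ∈ N.primeFactors, ((q : ℚ) ^ 2) ^ e q) * (QuadraticAlgebra.norm w) ^ 3 := by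
  rw [map_mul, map_mul, map_mul, map_mul, map_pow, map_pow, map_pow, norm_prodPow, norm_zeta, norm_zeta_sub_one,
    norm_sign' hs]
  ring

/-- `N(w) ≠ 0` for `w ≠ 0` (private). [cite: CohenPazuki2009, Definition 1.3 (G₃)] -/
private theorem norm_ne_zero' {w : K3} (hw : w ≠ 0) : QuadraticAlgebra.norm w ≠ 0 := by
  intro h0
  have h := algebraMap_norm_eq_mul_star w
  rw [h0, map_zero] at h
  rcases mul_eq_zero.mp h.symm with h1 | h1
  · exact hw h1
  · exact hw (star_eq_zero.mp h1)

/-! ## Valuations of `∏ q^{2e_q}` -/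

/-- `v_p(∏_{q ∈ s} (q²)^{e_q}) = 2 e_p` if `p ∈ s`, else `0`, for a set `s` of primes.
[cite: SilvermanAEC2009, Prop. VIII.1.6 (proof)] -/
theorem padicValRat_prodPow_sq (p : ℕ) [hp : Fact p.Prime] (s : Finset ℕ) (hs : ∀ q ∈ s, q.Prime) (e : ℕ → ℕ) :
    padicValRat p (∏ q ∈ s, ((q : ℚ) ^ 2) ^ e q) = if p ∈ s then 2 * (e p : ℤ) else 0 := by
  classical
  induction s using Finset.induction_on with
  | empty => simp
  | insert a s ha ih =>
    have hs' : ∀ q ∈ s, q.Prime := fun q hq => hs q (Finset.mem_insert_of_mem hq)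
    have hapr : a.Prime := hs a (Finset.mem_insert_self a s)
    have ha0 : (a : ℚ) ≠ 0 := Nat.cast_ne_zero.mpr hapr.ne_zero
    have hne : (∏ q ∈ s, ((q : ℚ) ^ 2) ^ e q) ≠ 0 :=
      Finset.prod_ne_zero_iff.mpr fun q hq => pow_ne_zero _ (pow_ne_zero _ (Nat.cast_ne_zero.mpr (hs' q hq).ne_zero))
    have hva : padicValRat p (((a : ℚ) ^ 2) ^ e a) = if p = a then 2 * (e a : ℤ) else 0 := by
      rw [padicValRat.pow, padicValRat.pow]
      by_cases hpa : p = a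
      · subst hpa
        rw [if_pos rfl, padicValRat.self hp.out.one_lt]; ring
      · rw [if_neg hpa, padicValRat.of_nat]
        have : padicValNat p a = 0 :=
          padicValNat.eq_zero_of_not_dvd fun h => hpa ((Nat.prime_dvd_prime_iff_eq hp.out hapr).mp h)
        rw [this]; simp
    rw [Finset.prod_insert ha, padicValRat.mul (pow_ne_zero _ (pow_ne_zero _ ha0)) hne, hva, ih hs']
    by_cases hpa : p = a
    · subst hpa
      rw [if_pos rfl, if_neg ha, if_pos (Finset.mem_insert_self p s)]; ring
    · rw [if_neg hpa, zero_add]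
      by_cases hps : p ∈ s
      · rw [if_pos hps, if_pos (Finset.mem_insert_of_mem hps)]
      · have hn : p ∉ insert a s := fun h => by
          rcases Finset.mem_insert.mp h with h | h
          · exact hpa h
          · exact hps h
        rw [if_neg hps, if_neg hn]

/-! ## The norm-cube condition kills `λ` and the inert primes -/

/-- **The norm-cube condition (inert support)**: if `N(s ζ^i (ζ−1)^j (∏_{q ∣ N} q^{e_q}) w³)` is the cube of a
rational number (`w ≠ 0`, `j < 3`, `e_q < 3`, the `q ∣ N` equal to `2` or `≡ 2 (mod 3)`) then `j = 0` and
`e_q = 0` for all `q ∣ N` — `3^j ∏ q^{2e_q}` must be a cube, and its valuations at `3` and at `q` are `j`, `2e_q`.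
[cite: CohenPazuki2009, Definition 1.3 (G₃) with Theorem 2.1] -/
theorem exponents_eq_zero_of_norm_cube_inert {N : ℕ} (hN0 : N ≠ 0) (hN : ∀ q ∈ N.primeFactors, q = 2 ∨ q % 3 = 2)
    {s : ℤ} (hs : s = 1 ∨ s = -1) {i j : ℕ} {e : ℕ → ℕ} (hj : j < 3) (he : ∀ q, e q < 3) {w : K3} (hw : w ≠ 0)
    {r : ℚ} (hr : QuadraticAlgebra.norm ((s : K3) * zeta ^ i * (zeta - 1) ^ j *
      (∏ q ∈ N.primeFactors, (q : K3) ^ e q) * w ^ 3) = r ^ 3) :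
    j = 0 ∧ ∀ q ∈ N.primeFactors, e q = 0 := by
  haveI : Fact (Nat.Prime 3) := ⟨Nat.prime_three⟩
  rw [norm_normalForm_inert hs] at hr
  have hNw := norm_ne_zero' hw
  set Nw := QuadraticAlgebra.norm w with hNwdef
  have hprimes : ∀ q ∈ N.primeFactors, q.Prime := fun q hq => Nat.prime_of_mem_primeFactors hq
  have hP : (∏ q ∈ N.primeFactors, ((q : ℚ) ^ 2) ^ e q) ≠ 0 :=
    Finset.prod_ne_zero_iff.mpr fun q hq => pow_ne_zero _ (pow_ne_zero _ (Nat.cast_ne_zero.mpr (hprimes q hq).ne_zero))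
  have hA : (3 : ℚ) ^ j * (∏ q ∈ N.primeFactors, ((q : ℚ) ^ 2) ^ e q) ≠ 0 := mul_ne_zero (pow_ne_zero _ (by norm_num)) hP
  have hr0 : r ≠ 0 := by
    rintro rfl
    rw [zero_pow three_ne_zero] at hr
    exact (mul_ne_zero hA (pow_ne_zero 3 hNw)) hr
  -- `3^j ∏ q^{2e_q} = (r / N(w))³`
  have key : (3 : ℚ) ^ j * (∏ q ∈ N.primeFactors, ((q : ℚ) ^ 2) ^ e q) = (r / Nw) ^ 3 := by
    rw [div_pow, eq_div_iff (pow_ne_zero 3 hNw), hr]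
  have h3N : (3 : ℕ) ∉ N.primeFactors := fun h => not_three_dvd_of_mem_primeFactors hN0 hN h (dvd_refl 3)
  have e3 : (3 : ℚ) = ((3 : ℕ) : ℚ) := by norm_num
  -- valuation at `3`: `j`
  have v3 : padicValRat 3 ((3 : ℚ) ^ j * ∏ q ∈ N.primeFactors, ((q : ℚ) ^ 2) ^ e q) = j := by
    rw [padicValRat.mul (pow_ne_zero _ (by norm_num)) hP, padicValRat.pow, e3,
      padicValRat.self (by norm_num), padicValRat_prodPow_sq 3 _ hprimes, if_neg h3N]
    ring
  have d3 : (3 : ℤ) ∣ (j : ℤ) := ⟨padicValRat 3 (r / Nw), by rw [← v3, key, padicValRat.pow]; push_cast; ring⟩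
  refine ⟨by omega, fun q₀ hq₀ => ?_⟩
  -- valuation at an inert `q₀ ∣ N`: `2 e_{q₀}`
  haveI : Fact q₀.Prime := ⟨hprimes q₀ hq₀⟩
  have hq3 : q₀ ≠ 3 := fun h => h3N (h ▸ hq₀)
  have v30 : padicValRat q₀ (3 : ℚ) = 0 := by
    rw [e3, padicValRat.of_nat]
    have : padicValNat q₀ 3 = 0 := padicValNat.eq_zero_of_not_dvd fun h =>
      hq3 ((Nat.prime_dvd_prime_iff_eq (hprimes q₀ hq₀) Nat.prime_three).mp h)
    rw [this]; simp
  have vq : padicValRat q₀ ((3 : ℚ) ^ j * ∏ q ∈ N.primeFactors, ((q : ℚ) ^ 2) ^ e q) = 2 * (e q₀ : ℤ) := by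
    rw [padicValRat.mul (pow_ne_zero _ (by norm_num)) hP, padicValRat.pow, v30,
      padicValRat_prodPow_sq q₀ _ hprimes, if_pos hq₀]
    ring
  have dq : (3 : ℤ) ∣ 2 * (e q₀ : ℤ) := ⟨padicValRat q₀ (r / Nw), by rw [← vq, key, padicValRat.pow]; push_cast; ring⟩
  have := he q₀
  omega

/-- **`G₃ ∩ K(S, 3) = ⟨[ζ]⟩` for `S = {λ} ∪ {q ∣ N}`, the `q` inert**: an element `b ∈ K3ˣ` with `3 ∣ ord_v(b)`
for every finite place `v ∌ 3N` and whose norm is a rational cube has cube class `[ζ^i]`, `i < 3`. For the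
`3`-descent of Cohen–Pazuki on `y² = x³ − 3(âx + b̂)²` with `2b̂√−3` supported on `λ` and inert primes this is
the whole Selmer box of the `ℤ/3ℤ`-kernel side. [cite: CohenPazuki2009, Definition 1.3 and Theorem 2.1] -/
theorem exists_cubeClass_eq_zeta_pow_of_norm_cube_inert {N : ℕ} (hN0 : N ≠ 0)
    (hN : ∀ q ∈ N.primeFactors, q = 2 ∨ q % 3 = 2) {b : K3} (hb : b ≠ 0)
    (hval : ∀ v : HeightOneSpectrum (𝓞 K3), ((3 * N : ℕ) : 𝓞 K3) ∉ v.asIdeal → (3 : ℤ) ∣ log (v.valuation K3 b))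
    (hnorm : ∃ r : ℚ, QuadraticAlgebra.norm b = r ^ 3) :
    ∃ i : ℕ, i < 3 ∧ cubeClass b = cubeClass (zeta ^ i) := by
  obtain ⟨s, i, j, e, w, hs, hi, hj, he, hw, hb_eq⟩ := exists_normal_form_inert hN0 hN hb hval
  obtain ⟨r, hr⟩ := hnorm
  rw [hb_eq] at hr
  obtain ⟨rfl, he0⟩ := exponents_eq_zero_of_norm_cube_inert hN0 hN hs hj he hw hr
  refine ⟨i, hi, ?_⟩
  have hprod : (∏ q ∈ N.primeFactors, (q : K3) ^ e q) = 1 :=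
    Finset.prod_eq_one fun q hq => by rw [he0 q hq, pow_zero]
  have hz : (zeta : K3) ≠ 0 := isPrimitiveRoot_zeta.ne_zero (by norm_num)
  have hs0 : (s : K3) ≠ 0 := by rcases hs with rfl | rfl <;> norm_num
  rw [hb_eq, hprod, pow_zero, mul_one, mul_one, cubeClass_mul_pow_three (mul_ne_zero hs0 (pow_ne_zero _ hz)) hw]
  -- `s = s³` for `s = ±1`
  have hs3 : (s : K3) = (s : K3) ^ 3 := by rcases hs with rfl | rfl <;> norm_num
  rw [hs3, mul_comm, cubeClass_mul_pow_three (pow_ne_zero _ hz) hs0]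

end K3

end Literature.NumberTheory.NumberFields
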